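import Summits.Ventures.YMGap.Thresholds.StarLimitTorus
import Literature.MathematicalPhysics.QuantumFieldTheory.LatticeGaugeShenZhuZhuProofs
import Literature.Probability.LatticeModels.SharpnessProofs
import HarnessLib

/-!
# Venture YMGap — the `ℤ^d` SMOOTHING-LIPSCHITZ lemma: one application of the lattice Yang–Mills
# kernel turns a bounded measurable local observable into a LIPSCHITZ CYLINDER FUNCTION

HONEST FRAMING: venture file (cell `pub-ymgap`, seat ds-3), strong-coupling LATTICE bookkeeping for
`SU(N)` lattice Yang–Mills on `ℤ^d` with the Wilson action (tree coupling `b`, specification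
`ymSpecification (fundamentalRep (Fin N)) b`). Nothing here is about the continuum, confinement, a
transfer-matrix gap or the Clay problem; no number of the cell moves on this file alone.

WHAT THIS IS. The DLR smoothing `γ_Λ F (η) = ∫ F dγ_Λ(· | η)` (`specAvg`) of a bounded measurable
observable `F` (`|F| ≤ M`) depending only on the links of the finite set `Λ` is (1) Lipschitz in every
outside link for the Frobenius distance with constant `M · wilsonSmoothLip N d b`
(`isLipBound_specAvg_ymSpecification`: tilt oscillation, Georgii 2011 Prop. 8.8 — the `ℤ^d` twin of
the tree's torus lemma `isLipBound_specAvg_torusWeightSpec`) and therefore (2) a LIPSCHITZ CYLINDER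
FUNCTION in the sense of the tree's `IsLipschitzCylinder (fundamentalRep (Fin N))` (the observable class
of Shen–Zhu–Zhu's Cor. 1.4 and of the cell's `MassGapAt`) on `Λ ∪ collar Λ` with constant
`#(Λ ∪ collar Λ) · N · M · wilsonSmoothLip N d b` (`isLipschitzCylinder_specAvg_ymSpecification`: Föllmer
interpolation + McShane extension). Used by the sibling file `MassGapAtMassive`.

References: H.-O. Georgii, Gibbs Measures and Phase Transitions, 2nd ed. (2011), Def. 1.23,
Prop. 8.8; H. Föllmer, LNM 1362 (1988) Ch. I Remark (2.17); E. J. McShane, Bull. AMS 40 (1934) 837;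
H. Shen, R. Zhu, X. Zhu, CMP 400 (2023) 805–851, §4.1 and Cor. 1.4.
-/

noncomputable section

open MeasureTheory ProbabilityTheory Function Finset Filter Topology
open scoped NNReal
open Literature.Probability.LatticeModels
open Literature.Probability.LatticeModels.DobrushinMetric
open Literature.MathematicalPhysics.QuantumLattice (IsCylinder LGConfig fundamentalRep fundamentalRep_apply
  fundamentalRep_mem_unitaryGroup continuous_fundamentalRep ymSpecification plaquettesTouching plaquetteEdges
  mem_plaquettesTouching_iff plaquetteObs isCylinder_plaquetteObs wilsonBoundaryAction
  continuous_wilsonBoundaryAction integral_ymSpecification dependsOn_integral_ymSpecification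
  exists_bound_of_continuous)
open Literature.MathematicalPhysics.QuantumFieldTheory
open Literature.MathematicalPhysics.QuantumFieldTheory.Balaban1983to89
open Literature.MathematicalPhysics.QuantumFieldTheory.Balaban1983to89.StrongCouplingTorusWindow
open Summit.Ventures.YMGap.StarLimit

namespace Summit.Ventures.YMGap.ZdSmoothing

variable {d N : ℕ}

/-! ### The Frobenius distance against the entry (sup) metric; McShane packaging -/

/-- `‖a − b‖_F ≤ N · max_{ij} |a_{ij} − b_{ij}|` on `SU(N)`: the Frobenius distance is dominated by
`N` times the entry (sup) metric. -/
theorem suFrobDist_le_mul_dist_suEntries (a b : Matrix.specialUnitaryGroup (Fin N) ℂ) :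
    suFrobDist a b ≤ (N : ℝ) * dist (suEntries a) (suEntries b) := by
  set δ : ℝ := dist (suEntries a) (suEntries b) with hδ
  have hentry : ∀ i j, ‖((a : Matrix (Fin N) (Fin N) ℂ) - (b : Matrix (Fin N) (Fin N) ℂ)) i j‖ ≤ δ := by
    intro i j
    rw [show ‖((a : Matrix (Fin N) (Fin N) ℂ) - (b : Matrix (Fin N) (Fin N) ℂ)) i j‖ =
      dist (suEntries a i j) (suEntries b i j) by rw [dist_eq_norm]; rfl]
    exact (dist_le_pi_dist _ _ j).trans (dist_le_pi_dist (suEntries a) (suEntries b) i)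
  have hsum : ∑ i : Fin N, ∑ j : Fin N,
      ‖((a : Matrix (Fin N) (Fin N) ℂ) - (b : Matrix (Fin N) (Fin N) ℂ)) i j‖ ^ 2 ≤ ((N : ℝ) * δ) ^ 2 :=
    calc ∑ i : Fin N, ∑ j : Fin N, ‖((a : Matrix (Fin N) (Fin N) ℂ) - (b : Matrix (Fin N) (Fin N) ℂ)) i j‖ ^ 2
        ≤ ∑ _i : Fin N, ∑ _j : Fin N, δ ^ 2 := Finset.sum_le_sum fun i _ => Finset.sum_le_sum fun j _ =>
          pow_le_pow_left₀ (norm_nonneg _) (hentry i j) 2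
      _ = ((N : ℝ) * δ) ^ 2 := by
          simp only [Finset.sum_const, Finset.card_univ, Fintype.card_fin, nsmul_eq_mul]; ring
  unfold suFrobDist frobNorm
  exact (Real.sqrt_le_sqrt hsum).trans (Real.sqrt_sq (by positivity)).le

/-- **McShane packaging**: an observable of `SU(N)` gauge fields on `ℤ^d` with
`|F U − F V| ≤ K · dist((U_e)_{e ∈ Λ}, (V_e)_{e ∈ Λ})` (entry/sup distance of the link tuple over `Λ`)
is a Lipschitz cylinder function with support `Λ` and constant `K` for the fundamental representation:
the induced function on the range of the entry map is `K`-Lipschitz and extends to the whole tuple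
space by McShane's lemma (`LipschitzOnWith.extend_real`). -/
theorem isLipschitzCylinder_of_dist_le
    {F : LGConfig d (Matrix.specialUnitaryGroup (Fin N) ℂ) → ℝ}
    {Λ : Finset (Literature.MathematicalPhysics.QuantumLattice.ZdEdge d)} {K : ℝ≥0}
    (h : ∀ U V, |F U - F V| ≤ K * dist (fun e : ↥Λ => suEntries (U e)) (fun e : ↥Λ => suEntries (V e))) :
    IsLipschitzCylinder (fundamentalRep (Fin N)) F Λ K := by
  classical
  set Φ : LGConfig d (Matrix.specialUnitaryGroup (Fin N) ℂ) → (↥Λ → Fin N → Fin N → ℂ) :=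
    fun U e => suEntries (U e) with hΦ
  have hkey : ∀ U V, Φ U = Φ V → F U = F V := fun U V hUV => by
    have h0 := h U V
    rw [show (fun e : ↥Λ => suEntries (U e)) = Φ U from rfl,
      show (fun e : ↥Λ => suEntries (V e)) = Φ V from rfl, hUV, dist_self, mul_zero] at h0
    exact eq_of_abs_sub_nonpos h0
  set g : (↥Λ → Fin N → Fin N → ℂ) → ℝ := fun m =>
    if hm : ∃ U, Φ U = m then F hm.choose else 0 with hg
  have hgΦ : ∀ U, g (Φ U) = F U := fun U => by
    have hex : ∃ V, Φ V = Φ U := ⟨U, rfl⟩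
    rw [hg]
    simp only [dif_pos hex]
    exact hkey _ _ hex.choose_spec
  have hgL : LipschitzOnWith K g (Set.range Φ) := by
    refine LipschitzOnWith.of_dist_le_mul ?_
    rintro _ ⟨U, rfl⟩ _ ⟨V, rfl⟩
    rw [hgΦ, hgΦ, Real.dist_eq]
    exact h U V
  obtain ⟨f, hf, hfg⟩ := hgL.extend_real
  refine ⟨f, hf, fun U => ?_⟩
  rw [show (fun (e : ↥Λ) (i j : Fin N) => (fundamentalRep (Fin N)) (U e) i j) = Φ U from rfl,
    ← hfg ⟨U, rfl⟩, hgΦ]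

/-- A Lipschitz cylinder function with constant `K` is one with any larger constant. -/
theorem isLipschitzCylinder_mono {G : Type*} [Group G] {ρ : G →* Matrix (Fin N) (Fin N) ℂ}
    {F : LGConfig d G → ℝ} {Λ : Finset (Literature.MathematicalPhysics.QuantumLattice.ZdEdge d)} {K K' : ℝ≥0}
    (h : IsLipschitzCylinder ρ F Λ K) (hK : K ≤ K') : IsLipschitzCylinder ρ F Λ K' := by
  obtain ⟨f, hf, hF⟩ := h
  exact ⟨f, hf.weaken hK, hF⟩

/-! ### The Wilson boundary action moves Lipschitz-little under a change of ONE link -/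

/-- Configurations agreeing off `y` are updates of each other at `y`. -/
theorem eq_update_of_eq_off {G : Type*} {U V : LGConfig d G} {y : Literature.MathematicalPhysics.QuantumLattice.ZdEdge d}
    (hUV : ∀ z, z ≠ y → U z = V z) : V = Function.update U y (V y) := by
  classical
  funext z
  by_cases hz : z = y
  · subst hz; simp
  · rw [Function.update_of_ne hz, hUV z hz]

/-- **One-link Lipschitz bound for the boundary Wilson action** (`SU(N)`, fundamental representation):
if `U = V` off the link `y`, then
`|S_Λ(U) − S_Λ(V)| ≤ 2(d−1) · √N · ‖U_y − V_y‖_F` — only the `≤ 2(d−1)` plaquettes through `y`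
contribute (`card_plaquettesTouching_singleton_le`), each by `≤ √N ‖U_y − V_y‖_F` because the
plaquette action is affine in each link (`re_trace_holonomy_update`, `abs_re_trace_su_mul_sub_le`). -/
theorem abs_wilsonBoundaryAction_sub_le_of_eq_off (Λ : Finset (Literature.MathematicalPhysics.QuantumLattice.ZdEdge d))
    {U V : LGConfig d (Matrix.specialUnitaryGroup (Fin N) ℂ)} {y : Literature.MathematicalPhysics.QuantumLattice.ZdEdge d}
    (hUV : ∀ z, z ≠ y → U z = V z) :
    |wilsonBoundaryAction (fundamentalRep (Fin N)) Λ U - wilsonBoundaryAction (fundamentalRep (Fin N)) Λ V| ≤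
      ((2 * (d - 1) : ℕ) : ℝ) * (Real.sqrt N * suFrobDist (U y) (V y)) := by
  classical
  set P := plaquettesTouching Λ with hP
  set Py := P.filter fun p => y ∈ plaquetteEdges p with hPy
  have hterm : ∀ p : Literature.MathematicalPhysics.QuantumLattice.ZdPlaquette d,
      |plaquetteObs (fundamentalRep (Fin N)) p.1 p.2.1.1 p.2.1.2 U -
          plaquetteObs (fundamentalRep (Fin N)) p.1 p.2.1.1 p.2.1.2 V| ≤
        if y ∈ plaquetteEdges p then Real.sqrt N * suFrobDist (U y) (V y) else 0 := by
    intro p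
    split_ifs with hy
    · -- the plaquette action is affine in the link `y`: `Re tr U_p = Re tr(a · staple)` (p2's
      -- `LatticeBakryEmery.abs_plaquetteObs_update_sub_le`, re-derived to keep the imports light)
      have hupd : ∀ a a' : Matrix.specialUnitaryGroup (Fin N) ℂ,
          |plaquetteObs (fundamentalRep (Fin N)) p.1 p.2.1.1 p.2.1.2 (Function.update U y a) -
              plaquetteObs (fundamentalRep (Fin N)) p.1 p.2.1.1 p.2.1.2 (Function.update U y a')| ≤
            Real.sqrt N * suFrobDist a a' := fun a a' => by
        unfold plaquetteObs
        rw [re_trace_holonomy_update (fundamentalRep (Fin N)) fundamentalRep_mem_unitaryGroup hy U a,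
          re_trace_holonomy_update (fundamentalRep (Fin N)) fundamentalRep_mem_unitaryGroup hy U a',
          fundamentalRep_apply, fundamentalRep_apply, fundamentalRep_apply]
        refine (abs_re_trace_su_mul_sub_le a a' _).trans ?_
        rw [frobNorm_su, mul_comm]
      have h := hupd (U y) (V y)
      rwa [Function.update_eq_self y U, ← eq_update_of_eq_off hUV] at h
    · have heq : plaquetteObs (fundamentalRep (Fin N)) p.1 p.2.1.1 p.2.1.2 U =
          plaquetteObs (fundamentalRep (Fin N)) p.1 p.2.1.1 p.2.1.2 V :=
        isCylinder_plaquetteObs (fundamentalRep (Fin N)) p fun z hz =>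
          hUV z fun hzy => hy (hzy ▸ Finset.mem_coe.1 hz)
      rw [heq, sub_self, abs_zero]
  have hdiff : wilsonBoundaryAction (fundamentalRep (Fin N)) Λ U - wilsonBoundaryAction (fundamentalRep (Fin N)) Λ V =
      ∑ p ∈ P, (plaquetteObs (fundamentalRep (Fin N)) p.1 p.2.1.1 p.2.1.2 V -
        plaquetteObs (fundamentalRep (Fin N)) p.1 p.2.1.1 p.2.1.2 U) := by
    unfold wilsonBoundaryAction
    rw [← hP, ← Finset.sum_sub_distrib]
    refine Finset.sum_congr rfl fun p _ => ?_
    ring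
  rw [hdiff]
  refine (Finset.abs_sum_le_sum_abs _ _).trans ?_
  have hPy_sub : Py ⊆ plaquettesTouching {y} := fun p hp => by
    rw [hPy, Finset.mem_filter] at hp
    exact mem_plaquettesTouching_singleton.2 hp.2
  have hcard : (Py.card : ℝ) ≤ ((2 * (d - 1) : ℕ) : ℝ) := by
    exact_mod_cast (Finset.card_le_card hPy_sub).trans (card_plaquettesTouching_singleton_le y)
  have hnn : 0 ≤ Real.sqrt N * suFrobDist (U y) (V y) :=
    mul_nonneg (Real.sqrt_nonneg _) (suFrobDist_nonneg _ _)
  calc ∑ p ∈ P, |plaquetteObs (fundamentalRep (Fin N)) p.1 p.2.1.1 p.2.1.2 V -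
          plaquetteObs (fundamentalRep (Fin N)) p.1 p.2.1.1 p.2.1.2 U|
      ≤ ∑ p ∈ P, (if y ∈ plaquetteEdges p then Real.sqrt N * suFrobDist (U y) (V y) else 0) :=
        Finset.sum_le_sum fun p _ => by rw [abs_sub_comm]; exact hterm p
    _ = (Py.card : ℝ) * (Real.sqrt N * suFrobDist (U y) (V y)) := by
        rw [← Finset.sum_filter, ← hPy, Finset.sum_const, nsmul_eq_mul]
    _ ≤ ((2 * (d - 1) : ℕ) : ℝ) * (Real.sqrt N * suFrobDist (U y) (V y)) :=
        mul_le_mul_of_nonneg_right hcard hnn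

/-- Gluing the same inside data onto two outside configurations that agree off `y` gives
configurations that agree off `y`. -/
theorem glueWith_congr_of_eq_off {G : Type*} (Λ : Finset (Literature.MathematicalPhysics.QuantumLattice.ZdEdge d))
    {σ τ : LGConfig d G} {y : Literature.MathematicalPhysics.QuantumLattice.ZdEdge d}
    (hστ : ∀ z, z ≠ y → σ z = τ z) (ζ : ↥Λ → G) {z : Literature.MathematicalPhysics.QuantumLattice.ZdEdge d}
    (hz : z ≠ y) : glueWith Λ ζ σ z = glueWith Λ ζ τ z := by
  by_cases hzΛ : z ∈ Λ
  · rw [glueWith_apply_mem _ _ _ hzΛ, glueWith_apply_mem _ _ _ hzΛ]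
  · rw [glueWith_apply_not_mem _ _ _ hzΛ, glueWith_apply_not_mem _ _ _ hzΛ, hστ z hz]

/-! ### The kernel average as a tilted product-Haar integral; the one-link Lipschitz bound -/

section Kernel

variable {G : Type*} [Group G] [TopologicalSpace G] [IsTopologicalGroup G] [CompactSpace G]
  [MeasurableSpace G] [BorelSpace G] [SecondCountableTopology G] (ρ : G →* Matrix (Fin N) (Fin N) ℂ)

/-- **The `ℤ^d` kernel average as a tilted product-Haar integral**:
`γ_Λ F (η) = ∫ F(ζ ∨ η) μ_η(dζ)` with `μ_η = Haar^{⊗Λ}.tilted (ζ ↦ −b S_Λ(ζ ∨ η))`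
(change of variables `map_tilted_comp`; the `ℤ^d` twin of the tree's `specAvg_torusWeightSpec_eq`). -/
theorem specAvg_ymSpecification_eq_tilted (hρ : Continuous ρ) (b : ℝ)
    (Λ : Finset (Literature.MathematicalPhysics.QuantumLattice.ZdEdge d))
    {F : LGConfig d G → ℝ} (hFm : Measurable F) (η : LGConfig d G) :
    specAvg (ymSpecification ρ b) Λ F η =
      ∫ ζ, F (glueWith Λ ζ η) ∂((Measure.pi fun _ : ↥Λ => haarProbability G).tilted
        fun ζ => -b * wilsonBoundaryAction ρ Λ (glueWith Λ ζ η)) := by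
  have hmeas : Measurable fun U : LGConfig d G => -b * wilsonBoundaryAction ρ Λ U :=
    (continuous_const.mul (continuous_wilsonBoundaryAction ρ hρ Λ)).measurable
  unfold specAvg ymSpecification
  rw [← map_tilted_comp _ (measurable_glueWith Λ η) hmeas,
    integral_map (measurable_glueWith Λ η).aemeasurable hFm.aestronglyMeasurable]
  rfl

end Kernel

/-- **The `ℤ^d` smoothing is Lipschitz in every outside link** (Georgii 2011, Prop. 8.8, tilt
oscillation — the `ℤ^d` twin of the tree's torus lemma `isLipBound_specAvg_torusWeightSpec`): for
`SU(N)` lattice Yang–Mills on `ℤ^d` at tree coupling `b` and `F` measurable inside `Λ` with `|F| ≤ M`,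
`|γ_Λ F(σ) − γ_Λ F(τ)| ≤ M · wilsonSmoothLip N d b · ‖σ_y − τ_y‖_F` whenever `σ = τ` off `y`
(for `y ∈ Λ` the left side vanishes). -/
theorem isLipBound_specAvg_ymSpecification (hN : 1 ≤ N) (b : ℝ)
    (Λ : Finset (Literature.MathematicalPhysics.QuantumLattice.ZdEdge d))
    {F : LGConfig d (Matrix.specialUnitaryGroup (Fin N) ℂ) → ℝ} (hFm : Measurable F)
    (hFdep : DependsOn F (↑Λ : Set (Literature.MathematicalPhysics.QuantumLattice.ZdEdge d)))
    {M : ℝ} (hM : ∀ U, |F U| ≤ M) :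
    IsLipBound suFrobDist (specAvg (ymSpecification (fundamentalRep (Fin N)) b) Λ F)
      fun _ => M * wilsonSmoothLip N d b := by
  classical
  haveI : SecondCountableTopology (Matrix (Fin N) (Fin N) ℂ) :=
    inferInstanceAs (SecondCountableTopology (Fin N → Fin N → ℂ))
  haveI : SecondCountableTopology (Matrix.specialUnitaryGroup (Fin N) ℂ) :=
    Topology.IsEmbedding.subtypeVal.secondCountableTopology
  have hρc := continuous_fundamentalRep (Fin N)
  have hM0 : 0 ≤ M := (abs_nonneg _).trans (hM fun _ => 1)
  have hN0 : (0 : ℝ) < N := by exact_mod_cast hN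
  set D : ℝ := 2 * Real.sqrt N with hDdef
  have hD : 0 < D := by rw [hDdef]; positivity
  set a : ℝ := 2 * (((2 * (d - 1) : ℕ) : ℝ) * (|b| * Real.sqrt N)) with ha
  have ha0 : 0 ≤ a := by positivity
  have hEdef : wilsonSmoothLip N d b = (Real.exp (D * a) - 1) / D := rfl
  have hE0 : 0 ≤ wilsonSmoothLip N d b := wilsonSmoothLip_nonneg hN d b
  refine ⟨fun _ => mul_nonneg hM0 hE0, fun y σ τ hστ => ?_⟩
  by_cases hy : y ∈ Λ
  · -- inside link: the kernel does not see `σ_y`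
    have hglue : ∀ ζ : ↥Λ → Matrix.specialUnitaryGroup (Fin N) ℂ, glueWith Λ ζ σ = glueWith Λ ζ τ :=
      fun ζ => funext fun z => by
        by_cases hzy : z = y
        · subst hzy; rw [glueWith_apply_mem _ _ _ hy, glueWith_apply_mem _ _ _ hy]
        · exact glueWith_congr_of_eq_off Λ hστ ζ hzy
    rw [specAvg_ymSpecification_eq_tilted _ hρc b Λ hFm σ,
      specAvg_ymSpecification_eq_tilted _ hρc b Λ hFm τ]
    simp_rw [hglue]
    rw [sub_self, abs_zero]
    exact mul_nonneg (mul_nonneg hM0 hE0) (suFrobDist_nonneg _ _)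
  · -- outside link: tilt oscillation
    rw [specAvg_ymSpecification_eq_tilted _ hρc b Λ hFm σ,
      specAvg_ymSpecification_eq_tilted _ hρc b Λ hFm τ]
    have hint : ∀ ζ : ↥Λ → Matrix.specialUnitaryGroup (Fin N) ℂ, F (glueWith Λ ζ τ) = F (glueWith Λ ζ σ) :=
      fun ζ => hFdep fun z hz => by
        rw [glueWith_apply_mem _ _ _ hz, glueWith_apply_mem _ _ _ hz]
    simp_rw [hint]
    have hSc : Continuous fun U : LGConfig d (Matrix.specialUnitaryGroup (Fin N) ℂ) =>
        -b * wilsonBoundaryAction (fundamentalRep (Fin N)) Λ U :=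
      continuous_const.mul (continuous_wilsonBoundaryAction _ hρc Λ)
    have hc : ∀ η : LGConfig d (Matrix.specialUnitaryGroup (Fin N) ℂ), Continuous fun ζ : ↥Λ → _ =>
        -b * wilsonBoundaryAction (fundamentalRep (Fin N)) Λ (glueWith Λ ζ η) := fun η =>
      hSc.comp ((Literature.MathematicalPhysics.QuantumLattice.continuous_glueWith_prod Λ).comp
        (Continuous.prodMk_right η))
    set ε : ℝ := |b| * (((2 * (d - 1) : ℕ) : ℝ) * (Real.sqrt N * suFrobDist (σ y) (τ y))) with hεdef
    have hε : ∀ ζ : ↥Λ → Matrix.specialUnitaryGroup (Fin N) ℂ,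
        |-b * wilsonBoundaryAction (fundamentalRep (Fin N)) Λ (glueWith Λ ζ σ) -
          -b * wilsonBoundaryAction (fundamentalRep (Fin N)) Λ (glueWith Λ ζ τ) - 0| ≤ ε := fun ζ => by
      rw [sub_zero, ← mul_sub, abs_mul, abs_neg]
      refine mul_le_mul_of_nonneg_left ?_ (abs_nonneg b)
      have h := abs_wilsonBoundaryAction_sub_le_of_eq_off (N := N) Λ
        (fun z hz => glueWith_congr_of_eq_off Λ hστ ζ hz)
      rwa [glueWith_apply_not_mem _ _ _ hy, glueWith_apply_not_mem _ _ _ hy] at h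
    have hφm : Measurable fun ζ : ↥Λ → Matrix.specialUnitaryGroup (Fin N) ℂ => F (glueWith Λ ζ σ) :=
      hFm.comp (measurable_glueWith Λ σ)
    have hφL : ∀ a' b' : ↥Λ → Matrix.specialUnitaryGroup (Fin N) ℂ,
        |F (glueWith Λ a' σ) - F (glueWith Λ b' σ)| ≤ 2 * M := fun a' b' =>
      (abs_sub _ _).trans (by linarith [hM (glueWith Λ a' σ), hM (glueWith Λ b' σ)])
    have key := abs_integral_tilted_sub_integral_tilted_le
      (Measure.pi fun _ : ↥Λ => haarProbability (Matrix.specialUnitaryGroup (Fin N) ℂ))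
      (hc σ).measurable (hc τ).measurable (exists_bound_of_continuous (hc σ))
      (exists_bound_of_continuous (hc τ)) (κ := 0) hε hφm ⟨M, fun ζ => hM _⟩ hφL
    refine key.trans ?_
    have hconv := exp_mul_sub_one_le_div_mul (k := suFrobDist (σ y) (τ y)) (K := D) (t := a)
      (suFrobDist_nonneg _ _) (suFrobDist_le _ _) hD ha0
    have e1 : 2 * ε = suFrobDist (σ y) (τ y) * a := by rw [hεdef, ha]; ring
    rw [e1]
    calc (Real.exp (suFrobDist (σ y) (τ y) * a) - 1) / 2 * (2 * M)
        = M * (Real.exp (suFrobDist (σ y) (τ y) * a) - 1) := by ring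
      _ ≤ M * (suFrobDist (σ y) (τ y) / D * (Real.exp (D * a) - 1)) :=
          mul_le_mul_of_nonneg_left hconv hM0
      _ = M * ((Real.exp (D * a) - 1) / D) * suFrobDist (σ y) (τ y) := by ring
      _ = M * wilsonSmoothLip N d b * suFrobDist (σ y) (τ y) := by rw [hEdef]

/-! ### Joint Lipschitz bound and the Lipschitz-cylinder conclusion -/

/-- **Joint Lipschitz bound of the smoothing in the entry metric**: with `T = Λ ∪ collar Λ` (the
dependence set of `γ_Λ F`, `dependsOn_integral_ymSpecification`),
`|γ_Λ F(U) − γ_Λ F(V)| ≤ #T · N · (M · wilsonSmoothLip N d b) · dist((U_e)_{e ∈ T}, (V_e)_{e ∈ T})`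
(Föllmer's interpolation over the links of `T`, then `‖·‖_F ≤ N · entry distance`). -/
theorem abs_specAvg_sub_le_mul_dist (hN : 1 ≤ N) (b : ℝ)
    (Λ : Finset (Literature.MathematicalPhysics.QuantumLattice.ZdEdge d))
    {F : LGConfig d (Matrix.specialUnitaryGroup (Fin N) ℂ) → ℝ} (hFm : Measurable F)
    (hFdep : DependsOn F (↑Λ : Set (Literature.MathematicalPhysics.QuantumLattice.ZdEdge d)))
    {M : ℝ} (hM : ∀ U, |F U| ≤ M) (U V : LGConfig d (Matrix.specialUnitaryGroup (Fin N) ℂ)) :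
    |specAvg (ymSpecification (fundamentalRep (Fin N)) b) Λ F U -
        specAvg (ymSpecification (fundamentalRep (Fin N)) b) Λ F V| ≤
      ((Λ ∪ (plaquettesTouching Λ).biUnion plaquetteEdges).card : ℝ) * N * (M * wilsonSmoothLip N d b) *
        dist (fun e : ↥(Λ ∪ (plaquettesTouching Λ).biUnion plaquetteEdges) => suEntries (U e))
          (fun e : ↥(Λ ∪ (plaquettesTouching Λ).biUnion plaquetteEdges) => suEntries (V e)) := by
  classical
  haveI : SecondCountableTopology (Matrix (Fin N) (Fin N) ℂ) :=
    inferInstanceAs (SecondCountableTopology (Fin N → Fin N → ℂ))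
  haveI : SecondCountableTopology (Matrix.specialUnitaryGroup (Fin N) ℂ) :=
    Topology.IsEmbedding.subtypeVal.secondCountableTopology
  set T := Λ ∪ (plaquettesTouching Λ).biUnion plaquetteEdges with hT
  set f := specAvg (ymSpecification (fundamentalRep (Fin N)) b) Λ F with hf
  have hdep : DependsOn f (↑T : Set (Literature.MathematicalPhysics.QuantumLattice.ZdEdge d)) := by
    rw [hf, hT]
    exact dependsOn_integral_ymSpecification (fundamentalRep (Fin N)) (continuous_fundamentalRep (Fin N))
      b Λ hFm hFdep
  have hlip := isLipBound_specAvg_ymSpecification (d := d) hN b Λ hFm hFdep hM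
  have hM0 : 0 ≤ M := (abs_nonneg _).trans (hM fun _ => 1)
  have hE0 : 0 ≤ wilsonSmoothLip N d b := wilsonSmoothLip_nonneg hN d b
  have hME : 0 ≤ M * wilsonSmoothLip N d b := mul_nonneg hM0 hE0
  set δ : ℝ := dist (fun e : ↥T => suEntries (U e)) (fun e : ↥T => suEntries (V e)) with hδ
  have hδ0 : 0 ≤ δ := dist_nonneg
  have hcoord : ∀ y ∈ T, suFrobDist (U y) (V y) ≤ (N : ℝ) * δ := fun y hy => by
    refine (suFrobDist_le_mul_dist_suEntries (U y) (V y)).trans ?_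
    refine mul_le_mul_of_nonneg_left ?_ (Nat.cast_nonneg _)
    exact dist_le_pi_dist (fun e : ↥T => suEntries (U e)) (fun e : ↥T => suEntries (V e)) ⟨y, hy⟩
  calc |f U - f V| ≤ ∑ y ∈ T, M * wilsonSmoothLip N d b * suFrobDist (U y) (V y) :=
        abs_sub_le_sum_of_dependsOn hdep hlip U V
    _ ≤ ∑ _y ∈ T, M * wilsonSmoothLip N d b * ((N : ℝ) * δ) :=
        Finset.sum_le_sum fun y hy => mul_le_mul_of_nonneg_left (hcoord y hy) hME
    _ = (T.card : ℝ) * N * (M * wilsonSmoothLip N d b) * δ := by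
        rw [Finset.sum_const, nsmul_eq_mul]; ring

/-- **The `ℤ^d` smoothing of a bounded measurable local observable is a LIPSCHITZ CYLINDER FUNCTION**
(`SU(N)`, fundamental representation, every `d`, every tree coupling `b`): for `F` measurable inside
`Λ` with `|F| ≤ M`, the kernel average `γ_Λ F` is an `IsLipschitzCylinder (fundamentalRep (Fin N))` on
`Λ ∪ collar Λ` with constant `#(Λ ∪ collar Λ) · N · M · wilsonSmoothLip N d b`. -/
theorem isLipschitzCylinder_specAvg_ymSpecification (hN : 1 ≤ N) (b : ℝ)
    (Λ : Finset (Literature.MathematicalPhysics.QuantumLattice.ZdEdge d))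
    {F : LGConfig d (Matrix.specialUnitaryGroup (Fin N) ℂ) → ℝ} (hFm : Measurable F)
    (hFdep : DependsOn F (↑Λ : Set (Literature.MathematicalPhysics.QuantumLattice.ZdEdge d)))
    {M : ℝ} (hM : ∀ U, |F U| ≤ M) :
    IsLipschitzCylinder (fundamentalRep (Fin N)) (specAvg (ymSpecification (fundamentalRep (Fin N)) b) Λ F)
      (Λ ∪ (plaquettesTouching Λ).biUnion plaquetteEdges)
      ((((Λ ∪ (plaquettesTouching Λ).biUnion plaquetteEdges).card : ℝ) * N *
        (M * wilsonSmoothLip N d b)).toNNReal) := by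
  refine isLipschitzCylinder_of_dist_le fun U V => ?_
  have h := abs_specAvg_sub_le_mul_dist (d := d) hN b Λ hFm hFdep hM U V
  have hM0 : 0 ≤ M := (abs_nonneg _).trans (hM fun _ => 1)
  have hnn : 0 ≤ (((Λ ∪ (plaquettesTouching Λ).biUnion plaquetteEdges).card : ℝ) * N *
      (M * wilsonSmoothLip N d b)) :=
    mul_nonneg (mul_nonneg (Nat.cast_nonneg _) (Nat.cast_nonneg _))
      (mul_nonneg hM0 (wilsonSmoothLip_nonneg hN d b))
  rwa [Real.coe_toNNReal _ hnn]

/-- **Uniform form** (support size only): the same conclusion with the constant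
`(1 + 4·2(d−1)) · #Λ · N · M · wilsonSmoothLip N d b`, which depends on `Λ` only through `#Λ`
(`card_union_collar_le`) — the form used for translated observables. -/
theorem isLipschitzCylinder_specAvg_ymSpecification_card (hN : 1 ≤ N) (b : ℝ)
    (Λ : Finset (Literature.MathematicalPhysics.QuantumLattice.ZdEdge d))
    {F : LGConfig d (Matrix.specialUnitaryGroup (Fin N) ℂ) → ℝ} (hFm : Measurable F)
    (hFdep : DependsOn F (↑Λ : Set (Literature.MathematicalPhysics.QuantumLattice.ZdEdge d)))
    {M : ℝ} (hM : ∀ U, |F U| ≤ M) {n : ℕ} (hn : Λ.card ≤ n) :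
    IsLipschitzCylinder (fundamentalRep (Fin N)) (specAvg (ymSpecification (fundamentalRep (Fin N)) b) Λ F)
      (Λ ∪ (plaquettesTouching Λ).biUnion plaquetteEdges)
      (((((1 + 4 * (2 * (d - 1))) * n : ℕ) : ℝ) * N * (M * wilsonSmoothLip N d b)).toNNReal) := by
  refine isLipschitzCylinder_mono (isLipschitzCylinder_specAvg_ymSpecification hN b Λ hFm hFdep hM) ?_
  have hM0 : 0 ≤ M := (abs_nonneg _).trans (hM fun _ => 1)
  have hME : 0 ≤ M * wilsonSmoothLip N d b := mul_nonneg hM0 (wilsonSmoothLip_nonneg hN d b)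
  refine Real.toNNReal_le_toNNReal ?_
  refine mul_le_mul_of_nonneg_right (mul_le_mul_of_nonneg_right ?_ (Nat.cast_nonneg _)) hME
  exact_mod_cast (card_union_collar_le Λ).trans (Nat.mul_le_mul_left _ hn)

end Summit.Ventures.YMGap.ZdSmoothing

end
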